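import Mathlib
import HarnessLib
import Summits.HubbardSuperconductivity.HubbardSuperconductivity.Theorems.KLProgrammeKLRegimeEnginePairTransferRelResBase

/-!
# Route `KLProgramme` — ENGINE child gen 8 (stmt-HubbardSuperconductivity-20437 `KLRegimeEngineV17F2`), class #5 rev 3 — THE ALL-Qm SPINE (cell STATUS (R247), regime (β) producer of record):
# the `n = 0` BASE of the private family, GUARD-GENERIC — `pairTransferRelResIdx_zero_of_smearingBound_all`
# (cell gate-hubbard-kl, seat hubbard-kl-k3c1-p1 g16; CLASS5-RESOLVED-STEP.md §14 / KLTC-INDEX v12 §S)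

WHY.  `pairTransferRelResIdx_zero_of_smearingBound` (…RelResBase) with the pair-class guard `IsPairClassAt L Qm 0` replaced by `C L Qm 0` (the antitonicity binder is carried
unused, `_hC`, so that every spine theorem has the same two leading binders).
Guard-generic plumbing over landed doors (token move `IsPairClassAt L Qm ↦ C L Qm`, `C` any ANTITONE guard; the all-Qm family is `C := fun _ _ _ => True`, the in-class family
`C := fun L Qm n => IsPairClassAt L Qm n`); nothing about the model's sizes is asserted; nothing asserts (X).3, (c), K3 or superconductivity.  0 kit · 0 lit.
-/

noncomputable section

namespace Summit.HubbardSuperconductivity.HubbardSuperconductivity.Theorems.KLRegimeSplit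

set_option linter.dupNamespace false -- summit = problem name (single-conjunct summit), D-0017

open Finset Matrix Set Literature.MathematicalPhysics.QuantumLattice Literature.Probability.LatticeModels
open Summit.HubbardSuperconductivity.HubbardSuperconductivity.Theorems.KLProgrammeCooperResummation
open Summit.HubbardSuperconductivity.HubbardSuperconductivity.Theorems.KLProgrammeLegKernels
open Summit.HubbardSuperconductivity.HubbardSuperconductivity.Theorems.DispersionFlow
open Summit.HubbardSuperconductivity.HubbardSuperconductivity.Theorems.EngineV8

section BaseAll

variable (L M : ℕ) [NeZero L] [NeZero M]

/-- **The `n = 0` base of the private relative-residue family from ONE smearing estimate per pair, GUARD-GENERIC** (twin of `pairTransferRelResIdx_zero_of_smearingBound`) (see the module docstring). -/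
theorem pairTransferRelResIdx_zero_of_smearingBound_all (C : ∀ L : ℕ, TorusSite 2 L → ℕ → Prop) (_hC : ∀ (L : ℕ) (Qm : TorusSite 2 L) (j n : ℕ), j ≤ n → C L Qm n → C L Qm j) {β U μ : ℝ} {mA : ℝ} (hm : 0 ≤ mA)
    {RB : ℕ → ℕ → ℕ → TorusSite 2 L → TorusSite 2 L → TorusSite 2 L → ℝ}
    (hdata : ∀ j j' : ℕ, 0 ≤ j' → j' ≤ j → j ≤ nScales β + 1 → ∀ Qm : TorusSite 2 L, C L Qm 0 →
      ∃ η : TorusSite 2 L → TorusSite 2 L → ℝ,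
        (∀ x y, ‖klMemberArrayF L M β U μ 0 (softSymbolCompl L M β μ (klFlowFrameU L M β U μ 0) 0 j) Qm x y‖ ≤ mA) ∧
        (∀ x y, ‖klMemberArrayF L M β U μ 0 (softSymbolCompl L M β μ (klFlowFrameU L M β U μ 0) 0 j') Qm x y‖ ≤ mA) ∧
        (∀ k ∈ klBall L μ 0, ∀ k' ∈ klBall L μ 0,
          ‖(klMemberArrayF L M β U μ 0 (softSymbolCompl L M β μ (klFlowFrameU L M β U μ 0) 0 j) Qm -
              klMemberArrayF L M β U μ 0 (softSymbolCompl L M β μ (klFlowFrameU L M β U μ 0) 0 j') Qm) k k'‖ ≤ η k k') ∧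
        (∀ k ∈ klBall L μ 0, ∀ k' ∈ klBall L μ 0, η k k' + mA * mA *
          ∑ c, ‖(-(((klTransferWeight L M β μ (klFlowFrameU L M β U μ 0) 0 (softSymbolCompl L M β μ (klFlowFrameU L M β U μ 0) 0 j) Qm c -
            klTransferWeight L M β μ (klFlowFrameU L M β U μ 0) 0 (softSymbolCompl L M β μ (klFlowFrameU L M β U μ 0) 0 j') Qm c : ℝ)) : ℂ))‖ ≤
          RB 0 j j' Qm k k')) :
    ∀ j j' : ℕ, 0 ≤ j' → j' ≤ j → j ≤ nScales β + 1 → ∀ Qm : TorusSite 2 L, C L Qm 0 →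
      ∀ k ∈ klBall L μ 0, ∀ k' ∈ klBall L μ 0,
      ‖(klMemberArrayF L M β U μ 0 (softSymbolCompl L M β μ (klFlowFrameU L M β U μ 0) 0 j) Qm +
          klMemberArrayF L M β U μ 0 (softSymbolCompl L M β μ (klFlowFrameU L M β U μ 0) 0 j) Qm *
          diagonal (fun c => -(((klTransferWeight L M β μ (klFlowFrameU L M β U μ 0) 0 (softSymbolCompl L M β μ (klFlowFrameU L M β U μ 0) 0 j) Qm c -
            klTransferWeight L M β μ (klFlowFrameU L M β U μ 0) 0 (softSymbolCompl L M β μ (klFlowFrameU L M β U μ 0) 0 j') Qm c : ℝ)) : ℂ)) *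
          klMemberArrayF L M β U μ 0 (softSymbolCompl L M β μ (klFlowFrameU L M β U μ 0) 0 j') Qm -
          klMemberArrayF L M β U μ 0 (softSymbolCompl L M β μ (klFlowFrameU L M β U μ 0) 0 j') Qm) k k'‖ ≤ RB 0 j j' Qm k k' := by
  intro j j' h1 h2 h3 Qm hQm k hk k' hk'
  obtain ⟨η, hA₁, hA₂, hη, hbud⟩ := hdata j j' h1 h2 h3 Qm hQm
  -- the difference bound, globally (zero off the ball)
  have hη' : ∀ x y, ‖(klMemberArrayF L M β U μ 0 (softSymbolCompl L M β μ (klFlowFrameU L M β U μ 0) 0 j) Qm -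
      klMemberArrayF L M β U μ 0 (softSymbolCompl L M β μ (klFlowFrameU L M β U μ 0) 0 j') Qm) x y‖ ≤
      (if x ∈ klBall L μ 0 ∧ y ∈ klBall L μ 0 then η x y else 0) := by
    intro x y
    by_cases hxy : x ∈ klBall L μ 0 ∧ y ∈ klBall L μ 0
    · rw [if_pos hxy]; exact hη x hxy.1 y hxy.2
    · rw [if_neg hxy, Matrix.sub_apply, klMemberArrayF_eq_zero_off β U μ 0 _ Qm hxy, klMemberArrayF_eq_zero_off β U μ 0 _ Qm hxy, sub_zero,
        norm_zero]
  have h := kltc_relResidue_le_of_sub _ _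
    (fun c => -(((klTransferWeight L M β μ (klFlowFrameU L M β U μ 0) 0 (softSymbolCompl L M β μ (klFlowFrameU L M β U μ 0) 0 j) Qm c -
      klTransferWeight L M β μ (klFlowFrameU L M β U μ 0) 0 (softSymbolCompl L M β μ (klFlowFrameU L M β U μ 0) 0 j') Qm c : ℝ)) : ℂ))
    _ hm hA₁ hA₂ hη' k k'
  rw [if_pos ⟨hk, hk'⟩] at h
  exact h.trans (hbud k hk k' hk')


end BaseAll

end Summit.HubbardSuperconductivity.HubbardSuperconductivity.Theorems.KLRegimeSplit

end
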